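import Literature.Analysis.OperatorTheory.InverseNormSpectrumLowerBound
import Mathlib.Analysis.Complex.AbsMax
import Mathlib.Analysis.Calculus.FDeriv.Mul
import Mathlib.Analysis.Calculus.DiffContOnCl
import Mathlib.Analysis.Normed.Operator.Banach
import HarnessLib

/-!
# Pseudospectral enclosure for an UNBOUNDED operator: an approximate eigenvector at the centre of a
# circle on which the inverses `(L − z)⁻¹` are bounded by `M < 1/ε` forces a spectral point in the disc

Topic `Literature/Analysis/OperatorTheory`. This is the unbounded-operator companion of
`PseudospectralEnclosure.lean` (which treats an element `a` of a complex Banach algebra, e.g. a bounded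
operator), written in the frame of `InverseNormSpectrumLowerBound.lean`: a Banach space `E`, a DOMAIN
`p ≤ E` (a bare submodule, no graph norm), a linear map `L : p →ₗ[𝕜] E`, the shifts
`resolventShift p L z = L − z : p → E`, bounded two-sided inverses `HasBoundedInverse p (L − z) B`, and the
weakest spectrum `MemSpectrum p L z` (`L − z` not bijective).

* `HasBoundedInverse.unique` — a bounded two-sided inverse is unique;
* `HasBoundedInverse.resolventShift_of_norm_lt`, `HasBoundedInverse.shift` — **stability of bounded
  invertibility** (Neumann series, Kato IV-§3.1 / Trefethen–Embree Thm. 4.1): a bounded inverse `B₀` of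
  `L − z₀` yields the explicit bounded inverse `B₀ (1 − (z − z₀) B₀)⁻¹` of `L − z` for `‖(z − z₀) B₀‖ < 1`;
* `bddResolventSet`, `bddResolvent` — the set of `z` at which `L − z` has a bounded two-sided inverse and
  (a choice of) that inverse; `isOpen_bddResolventSet`; `differentiableAt_bddResolvent` — **the resolvent
  is holomorphic** on that open set (Kato III-§6.1), via Mathlib's `differentiableAt_inverse`;
* `exists_mem_closedBall_not_hasBoundedInverse` — **the enclosure**: if at every point of the circle
  `|z − μ| = r` (`r > 0`) the operator `L − z` has a bounded inverse of norm `≤ M`, and some `v ∈ p`,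
  `v ≠ 0`, has `‖(L − μ) v‖ ≤ ε ‖v‖` with `M ε < 1`, then at some point `z` of the closed disc
  `|z − μ| ≤ r` the operator `L − z` has NO bounded two-sided inverse (i.e. `z ∈ σ(L)` in the usual sense
  for closed operators). Proof as in the bounded case: otherwise `z ↦ (L − z)⁻¹` is holomorphic on a
  neighbourhood of the closed disc, the maximum principle for Banach-space-valued holomorphic functions
  (`Complex.norm_le_of_forall_mem_frontier_norm_le`; subharmonicity of the resolvent norm, Davies 2007
  Thm. 9.2.8 / Trefethen–Embree 2005 Thm. 4.2) gives `‖(L − μ)⁻¹‖ ≤ M`, while the approximate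
  eigenvector gives `‖(L − μ)⁻¹‖ ≥ 1/ε > M` (Davies 2007 Lemma 9.1.2; Trefethen–Embree Thm. 4.3);
* `hasBoundedInverse_of_bijective_of_isClosed_graph` — for a CLOSED operator (graph of `L` closed in
  `E × E`) a bijective `L − z` has a bounded inverse (closed graph theorem,
  `LinearMap.continuous_of_isClosed_graph`), whence the same enclosure with the conclusion
  `MemSpectrum p L z` (`exists_memSpectrum_closedBall_of_isClosed_graph`).

Why it is here: the certification step that turns a validated-numerics RESIDUAL bound for a candidate
eigenpair of a non-normal DIFFERENTIAL operator (closed, unbounded: e.g. the linearisation of the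
Navier–Stokes profile equation in similarity variables on `L²_σ(ℝ³)`, Jia–Šverák 2015 / Guillod–Šverák 2023,
where a small residual alone proves only membership in a pseudospectrum) plus a certified bound for
`‖(L − z)⁻¹‖` on a surrounding circle into the existence of a spectral point in the disc. Everything is
proved; no named facts; nothing about any particular operator is asserted.

## References

* E. B. Davies, *Linear Operators and their Spectra*, Cambridge Univ. Press 2007, Lemma 9.1.2, Thm. 9.2.8.
  [Davies2007]
* L. N. Trefethen, M. Embree, *Spectra and Pseudospectra*, Princeton Univ. Press 2005, §4, Thms. 4.1–4.3
  (closed operators). [TrefethenEmbree2005]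
* T. Kato, *Perturbation Theory for Linear Operators*, Springer 1966/1976, III-§6.1 (holomorphy of the
  resolvent), IV-§3.1 (Neumann series), III-§5.4 (closed graph theorem). [Kato1966]
-/

noncomputable section

open _root_.Metric _root_.Set _root_.Filter _root_.Topology _root_.Bornology

namespace Literature.Analysis.OperatorTheory

section General

variable {𝕜 E : Type*} [NontriviallyNormedField 𝕜] [NormedAddCommGroup E] [NormedSpace 𝕜 E]

/-- Shifts compose: `(L − z) − w = L − (z + w)`. [folklore] -/
theorem resolventShift_resolventShift (p : Submodule 𝕜 E) (L : p →ₗ[𝕜] E) (z w : 𝕜) :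
    resolventShift p (resolventShift p L z) w = resolventShift p L (z + w) := by
  ext u
  simp only [resolventShift_apply, add_smul]
  abel

/-- `resolventShift p L 0 = L`. [folklore] -/
@[simp] theorem resolventShift_zero (p : Submodule 𝕜 E) (L : p →ₗ[𝕜] E) :
    resolventShift p L 0 = L := by
  ext u
  simp only [resolventShift_apply, zero_smul, sub_zero]

/-- **A bounded two-sided inverse is unique.** [folklore] -/
theorem HasBoundedInverse.unique {p : Submodule 𝕜 E} {L : p →ₗ[𝕜] E} {B B' : E →L[𝕜] E}
    (h : HasBoundedInverse p L B) (h' : HasBoundedInverse p L B') : B = B' := by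
  ext f
  have h1 := h'.left_inv ⟨B f, h.mem f⟩
  rw [h.right_inv f] at h1
  exact h1.symm

/-- A bounded two-sided inverse makes the operator bijective. [folklore] -/
theorem HasBoundedInverse.bijective {p : Submodule 𝕜 E} {L : p →ₗ[𝕜] E} {B : E →L[𝕜] E}
    (h : HasBoundedInverse p L B) : Function.Bijective L := by
  constructor
  · intro u v huv
    have := congrArg B huv
    rw [h.left_inv, h.left_inv] at this
    exact Subtype.ext this
  · intro f
    exact ⟨⟨B f, h.mem f⟩, h.right_inv f⟩

/-- A bounded inverse at `z` excludes `z` from the (weakest) spectrum. [folklore] -/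
theorem not_memSpectrum_of_hasBoundedInverse {p : Submodule 𝕜 E} {L : p →ₗ[𝕜] E}
    {B : E →L[𝕜] E} {z : 𝕜} (h : HasBoundedInverse p (resolventShift p L z) B) :
    ¬ MemSpectrum p L z := fun hz => hz h.bijective

/-- The norm identity behind the approximate-eigenvector bound: `‖u‖ ≤ ‖B‖ ‖L u‖`.
[cite: Davies2007, Lemma 9.1.2] -/
theorem HasBoundedInverse.norm_le {p : Submodule 𝕜 E} {L : p →ₗ[𝕜] E} {B : E →L[𝕜] E}
    (h : HasBoundedInverse p L B) (u : p) : ‖(u : E)‖ ≤ ‖B‖ * ‖L u‖ := by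
  calc ‖(u : E)‖ = ‖B (L u)‖ := by rw [h.left_inv]
    _ ≤ ‖B‖ * ‖L u‖ := B.le_opNorm _

/-- **Approximate eigenvectors bound the inverse from below**: if `L − μ` has a bounded inverse `B`
and some `v ≠ 0` in the domain has `‖(L − μ) v‖ ≤ ε ‖v‖`, then `1 ≤ ‖B‖ ε`.
[cite: Davies2007, Lemma 9.1.2] -/
theorem one_le_norm_mul_of_approxEigenvector {p : Submodule 𝕜 E} {L : p →ₗ[𝕜] E} {B : E →L[𝕜] E}
    {μ : 𝕜} {ε : ℝ} (h : HasBoundedInverse p (resolventShift p L μ) B) {v : p} (hv : v ≠ 0)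
    (hres : ‖resolventShift p L μ v‖ ≤ ε * ‖(v : E)‖) : 1 ≤ ‖B‖ * ε := by
  have hv' : (v : E) ≠ 0 := fun h0 => hv (Submodule.coe_eq_zero.mp h0)
  have hvpos : 0 < ‖(v : E)‖ := norm_pos_iff.mpr hv'
  have h1 := h.norm_le v
  have h2 : ‖(v : E)‖ ≤ ‖B‖ * (ε * ‖(v : E)‖) :=
    h1.trans (mul_le_mul_of_nonneg_left hres (norm_nonneg _))
  by_contra hlt
  push Not at hlt
  nlinarith [norm_nonneg B]

/-- The set of `z` at which `L − z` has a bounded two-sided inverse (the resolvent set of a closed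
operator). [folklore] -/
def bddResolventSet (p : Submodule 𝕜 E) (L : p →ₗ[𝕜] E) : Set 𝕜 :=
  {z | ∃ B : E →L[𝕜] E, HasBoundedInverse p (resolventShift p L z) B}

/-- A choice of the bounded inverse of `L − z` (zero off `bddResolventSet`). [folklore] -/
def bddResolvent (p : Submodule 𝕜 E) (L : p →ₗ[𝕜] E) (z : 𝕜) : E →L[𝕜] E := by
  classical
  exact if h : ∃ B : E →L[𝕜] E, HasBoundedInverse p (resolventShift p L z) B then h.choose else 0

/-- On `bddResolventSet`, `bddResolvent` IS the (unique) bounded inverse. [folklore] -/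
theorem bddResolvent_eq {p : Submodule 𝕜 E} {L : p →ₗ[𝕜] E} {B : E →L[𝕜] E} {z : 𝕜}
    (h : HasBoundedInverse p (resolventShift p L z) B) : bddResolvent p L z = B := by
  classical
  have hex : ∃ B : E →L[𝕜] E, HasBoundedInverse p (resolventShift p L z) B := ⟨B, h⟩
  unfold bddResolvent
  rw [dif_pos hex]
  exact hex.choose_spec.unique h

/-- `bddResolvent` is a bounded inverse at every point of `bddResolventSet`. [folklore] -/
theorem hasBoundedInverse_bddResolvent {p : Submodule 𝕜 E} {L : p →ₗ[𝕜] E} {z : 𝕜}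
    (hz : z ∈ bddResolventSet p L) : HasBoundedInverse p (resolventShift p L z) (bddResolvent p L z) := by
  obtain ⟨B, hB⟩ := hz
  rwa [bddResolvent_eq hB]

variable [CompleteSpace E]

/-- **Stability of bounded invertibility (Neumann series), explicit inverse**: if `B` is a bounded
two-sided inverse of `L` and `‖μ B‖ < 1`, then `B (1 − μ B)⁻¹` is a bounded two-sided inverse of
`L − μ`. [cite: Kato1966, IV-§3.1] -/
theorem HasBoundedInverse.resolventShift_of_norm_lt {p : Submodule 𝕜 E} {L : p →ₗ[𝕜] E}
    {B : E →L[𝕜] E} (h : HasBoundedInverse p L B) {μ : 𝕜} (hμ : ‖μ • B‖ < 1) :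
    HasBoundedInverse p (resolventShift p L μ)
      (B.comp (↑(Units.oneSub (μ • B) hμ)⁻¹ : E →L[𝕜] E)) := by
  set W : (E →L[𝕜] E)ˣ := Units.oneSub (μ • B) hμ with hW
  have hWval : (W : E →L[𝕜] E) = 1 - μ • B := rfl
  have hWinv : ∀ f, (W : E →L[𝕜] E) ((↑W⁻¹ : E →L[𝕜] E) f) = f := fun f => by
    rw [← ContinuousLinearMap.comp_apply, ← ContinuousLinearMap.mul_def, Units.mul_inv]
    rfl
  have hinvW : ∀ f, (↑W⁻¹ : E →L[𝕜] E) ((W : E →L[𝕜] E) f) = f := fun f => by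
    rw [← ContinuousLinearMap.comp_apply, ← ContinuousLinearMap.mul_def, Units.inv_mul]
    rfl
  refine ⟨fun f => h.mem _, fun f => ?_, fun u => ?_⟩
  · show resolventShift p L μ ⟨B ((↑W⁻¹ : E →L[𝕜] E) f), h.mem _⟩ = f
    rw [resolventShift_eq_oneSub_comp h, h.right_inv, ← hWval, hWinv]
  · show B ((↑W⁻¹ : E →L[𝕜] E) (resolventShift p L μ u)) = u
    rw [resolventShift_eq_oneSub_comp h, ← hWval, hinvW, h.left_inv]

/-- **Stability of bounded invertibility along shifts**: a bounded inverse `B₀` of `L − z₀` gives the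
bounded inverse `B₀ (1 − (z − z₀) B₀)⁻¹` of `L − z` whenever `‖(z − z₀) B₀‖ < 1`.
[cite: TrefethenEmbree2005, Thm. 4.1] -/
theorem HasBoundedInverse.shift {p : Submodule 𝕜 E} {L : p →ₗ[𝕜] E} {B₀ : E →L[𝕜] E} {z₀ : 𝕜}
    (h : HasBoundedInverse p (resolventShift p L z₀) B₀) {z : 𝕜} (hz : ‖(z - z₀) • B₀‖ < 1) :
    HasBoundedInverse p (resolventShift p L z)
      (B₀.comp (↑(Units.oneSub ((z - z₀) • B₀) hz)⁻¹ : E →L[𝕜] E)) := by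
  have := h.resolventShift_of_norm_lt hz
  have e : z₀ + (z - z₀) = z := by abel
  rwa [resolventShift_resolventShift, e] at this

/-- Local Neumann-series formula: near a point `z₀` with bounded inverse `B₀`,
`bddResolvent p L z = B₀ · (1 − (z − z₀) B₀)⁻¹`. [cite: Kato1966, IV-§3.1] -/
theorem bddResolvent_eventuallyEq {p : Submodule 𝕜 E} {L : p →ₗ[𝕜] E} {B₀ : E →L[𝕜] E} {z₀ : 𝕜}
    (h : HasBoundedInverse p (resolventShift p L z₀) B₀) :
    bddResolvent p L =ᶠ[𝓝 z₀]
      fun z => B₀ * Ring.inverse ((1 : E →L[𝕜] E) - (z - z₀) • B₀) := by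
  have hc : Continuous fun z : 𝕜 => ‖(z - z₀) • B₀‖ := by fun_prop
  have h0 : z₀ ∈ {z : 𝕜 | ‖(z - z₀) • B₀‖ < 1} := by simp
  have hmem : {z : 𝕜 | ‖(z - z₀) • B₀‖ < 1} ∈ 𝓝 z₀ :=
    (isOpen_lt hc continuous_const).mem_nhds h0
  filter_upwards [hmem] with z hz
  rw [bddResolvent_eq (h.shift hz), NormedRing.inverse_one_sub _ hz]
  rfl

/-- `bddResolventSet` is open. [cite: TrefethenEmbree2005, Thm. 4.1] -/
theorem isOpen_bddResolventSet (p : Submodule 𝕜 E) (L : p →ₗ[𝕜] E) :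
    IsOpen (bddResolventSet p L) := by
  rw [isOpen_iff_mem_nhds]
  rintro z₀ ⟨B₀, hB₀⟩
  have hc : Continuous fun z : 𝕜 => ‖(z - z₀) • B₀‖ := by fun_prop
  have h0 : z₀ ∈ {z : 𝕜 | ‖(z - z₀) • B₀‖ < 1} := by simp
  have hmem : {z : 𝕜 | ‖(z - z₀) • B₀‖ < 1} ∈ 𝓝 z₀ :=
    (isOpen_lt hc continuous_const).mem_nhds h0
  exact Filter.mem_of_superset hmem fun z hz => ⟨_, hB₀.shift hz⟩

/-- **The resolvent of an unbounded operator is holomorphic** where it exists as a bounded operator.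
[cite: Kato1966, III-§6.1] -/
theorem differentiableAt_bddResolvent {p : Submodule 𝕜 E} {L : p →ₗ[𝕜] E} {B₀ : E →L[𝕜] E}
    {z₀ : 𝕜} (h : HasBoundedInverse p (resolventShift p L z₀) B₀) :
    DifferentiableAt 𝕜 (bddResolvent p L) z₀ := by
  have hg : DifferentiableAt 𝕜 (fun z : 𝕜 => (1 : E →L[𝕜] E) - (z - z₀) • B₀) z₀ := by fun_prop
  have h1 : IsUnit ((fun z : 𝕜 => (1 : E →L[𝕜] E) - (z - z₀) • B₀) z₀) := by simp
  have hd : DifferentiableAt 𝕜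
      (fun z : 𝕜 => B₀ * Ring.inverse ((1 : E →L[𝕜] E) - (z - z₀) • B₀)) z₀ :=
    ((differentiableAt_inverse h1).comp z₀ hg).const_mul B₀
  exact (bddResolvent_eventuallyEq h).differentiableAt_iff.mpr hd

end General

section Enclosure

variable {E : Type*} [NormedAddCommGroup E] [NormedSpace ℂ E] [CompleteSpace E]
  {p : Submodule ℂ E} {L : p →ₗ[ℂ] E}

/-- **Maximum principle for the resolvent norm of an unbounded operator**: if every point of the
closed disc `|z − μ| ≤ r` (`r > 0`) carries a bounded inverse of `L − z`, and those on the circle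
`|z − μ| = r` have norm `≤ M`, then `‖(L − z)⁻¹‖ ≤ M` on the whole closed disc.
[cite: Davies2007, Thm. 9.2.8] -/
theorem norm_bddResolvent_le_of_closedBall_subset {μ : ℂ} {r M : ℝ} (hr : 0 < r)
    (h : closedBall μ r ⊆ bddResolventSet p L)
    (hM : ∀ z ∈ sphere μ r, ‖bddResolvent p L z‖ ≤ M) {z : ℂ} (hz : z ∈ closedBall μ r) :
    ‖bddResolvent p L z‖ ≤ M := by
  have hdiff : DifferentiableOn ℂ (bddResolvent p L) (closure (ball μ r)) := by
    rw [closure_ball μ hr.ne']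
    intro w hw
    exact (differentiableAt_bddResolvent (hasBoundedInverse_bddResolvent (h hw))).differentiableWithinAt
  have hd : DiffContOnCl ℂ (bddResolvent p L) (ball μ r) := hdiff.diffContOnCl
  refine Complex.norm_le_of_forall_mem_frontier_norm_le isBounded_ball hd (fun w hw => ?_) ?_
  · exact hM w (by rwa [frontier_ball μ hr.ne'] at hw)
  · rwa [closure_ball μ hr.ne']

/-- **Pseudospectral enclosure for an unbounded operator.** Let `p ≤ E` be a subspace of a complex
Banach space, `L : p → E` linear, `r > 0`. Suppose that at every point `z` of the circle `|z − μ| = r`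
the operator `L − z : p → E` has a bounded two-sided inverse of norm `≤ M`, and that some `v ∈ p`,
`v ≠ 0`, is an approximate eigenvector at `μ`: `‖(L − μ) v‖ ≤ ε ‖v‖`, with `M ε < 1`. Then at some
point of the closed disc `|z − μ| ≤ r` the operator `L − z` has no bounded two-sided inverse — a
spectral point of `L` (for a closed `L`: in the usual sense, see
`exists_memSpectrum_closedBall_of_isClosed_graph`).
[cite: Davies2007, Lemma 9.1.2 with Thm. 9.2.8; TrefethenEmbree2005, Thm. 4.3] -/
theorem exists_mem_closedBall_not_hasBoundedInverse {μ : ℂ} {r M ε : ℝ} (hr : 0 < r)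
    (hM : ∀ z ∈ sphere μ r, ∃ B : E →L[ℂ] E, HasBoundedInverse p (resolventShift p L z) B ∧ ‖B‖ ≤ M)
    {v : p} (hv : v ≠ 0) (hres : ‖resolventShift p L μ v‖ ≤ ε * ‖(v : E)‖) (hMε : M * ε < 1) :
    ∃ z ∈ closedBall μ r, ∀ B : E →L[ℂ] E, ¬ HasBoundedInverse p (resolventShift p L z) B := by
  by_contra hcon
  push Not at hcon
  -- every point of the closed disc carries a bounded inverse
  have hsub : closedBall μ r ⊆ bddResolventSet p L := fun z hz => hcon z hz
  have hM' : ∀ z ∈ sphere μ r, ‖bddResolvent p L z‖ ≤ M := by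
    intro z hz
    obtain ⟨B, hB, hBM⟩ := hM z hz
    rwa [bddResolvent_eq hB]
  -- maximum principle at the centre
  have hμM : ‖bddResolvent p L μ‖ ≤ M :=
    norm_bddResolvent_le_of_closedBall_subset hr hsub hM' (mem_closedBall_self hr.le)
  -- the approximate eigenvector gives the opposite inequality
  have hBμ := hasBoundedInverse_bddResolvent (hsub (mem_closedBall_self hr.le))
  have h1 := one_le_norm_mul_of_approxEigenvector hBμ hv hres
  have hε : 0 ≤ ε := by
    have hv' : (v : E) ≠ 0 := fun h0 => hv (Submodule.coe_eq_zero.mp h0)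
    have hvpos : 0 < ‖(v : E)‖ := norm_pos_iff.mpr hv'
    have := (norm_nonneg _).trans hres
    nlinarith
  have : ‖bddResolvent p L μ‖ * ε ≤ M * ε := mul_le_mul_of_nonneg_right hμM hε
  linarith

/-- Normalised residual form: `‖v‖ = 1`, `‖(L − μ) v‖ ≤ ε`. [cite: Davies2007, Lemma 9.1.2 with Thm. 9.2.8] -/
theorem exists_mem_closedBall_not_hasBoundedInverse' {μ : ℂ} {r M ε : ℝ} (hr : 0 < r)
    (hM : ∀ z ∈ sphere μ r, ∃ B : E →L[ℂ] E, HasBoundedInverse p (resolventShift p L z) B ∧ ‖B‖ ≤ M)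
    {v : p} (hv : ‖(v : E)‖ = 1) (hres : ‖resolventShift p L μ v‖ ≤ ε) (hMε : M * ε < 1) :
    ∃ z ∈ closedBall μ r, ∀ B : E →L[ℂ] E, ¬ HasBoundedInverse p (resolventShift p L z) B := by
  have hv0 : v ≠ 0 := by
    intro h0
    rw [h0, Submodule.coe_zero, norm_zero] at hv
    exact zero_ne_one hv
  exact exists_mem_closedBall_not_hasBoundedInverse hr hM hv0 (by rwa [hv, mul_one]) hMε

/-- **Exclusion form**: if the closed disc `|z − μ| ≤ r` (`r > 0`) consists of points with bounded
inverses and those on the circle have norm `≤ M`, then every `u` in the domain satisfies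
`‖u‖ ≤ M ‖(L − μ) u‖` — no approximate eigenvector at `μ` with residual below `M⁻¹` exists.
[cite: Davies2007, Thm. 9.2.8] -/
theorem norm_le_mul_norm_resolventShift_of_closedBall_subset {μ : ℂ} {r M : ℝ} (hr : 0 < r)
    (h : closedBall μ r ⊆ bddResolventSet p L)
    (hM : ∀ z ∈ sphere μ r, ‖bddResolvent p L z‖ ≤ M) (u : p) :
    ‖(u : E)‖ ≤ M * ‖resolventShift p L μ u‖ := by
  have hB := hasBoundedInverse_bddResolvent (h (mem_closedBall_self hr.le))
  exact (hB.norm_le u).trans (mul_le_mul_of_nonneg_right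
    (norm_bddResolvent_le_of_closedBall_subset hr h hM (mem_closedBall_self hr.le)) (norm_nonneg _))

/-- **Closed graph theorem for the shifted inverse**: if the graph of `L` is closed in `E × E` and
`L − z : p → E` is bijective, then `L − z` has a bounded two-sided inverse.
[cite: Kato1966, III-§5.4] -/
theorem hasBoundedInverse_of_bijective_of_isClosed_graph
    (hL : IsClosed {x : E × E | ∃ u : p, ((u : E), L u) = x}) {z : ℂ}
    (hbij : Function.Bijective (resolventShift p L z)) :
    ∃ B : E →L[ℂ] E, HasBoundedInverse p (resolventShift p L z) B := by
  let e : p ≃ₗ[ℂ] E := LinearEquiv.ofBijective (resolventShift p L z) hbij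
  have he : ∀ u : p, e u = resolventShift p L z u := fun u => rfl
  let g : E →ₗ[ℂ] E := p.subtype ∘ₗ (e.symm : E →ₗ[ℂ] p)
  have hg_apply : ∀ f : E, g f = ((e.symm f : p) : E) := fun f => rfl
  -- the graph of `g` is the swap of the graph of `L − z`, a continuous preimage of the graph of `L`
  have hgraph : (g.graph : Set (E × E)) =
      (fun x : E × E => (x.2, x.1 + z • x.2)) ⁻¹' {x : E × E | ∃ u : p, ((u : E), L u) = x} := by
    ext ⟨f, w⟩
    simp only [SetLike.mem_coe, LinearMap.mem_graph_iff, Set.mem_preimage, Set.mem_setOf_eq]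
    constructor
    · intro hw
      refine ⟨e.symm f, ?_⟩
      have h1 : resolventShift p L z (e.symm f) = f := by rw [← he, LinearEquiv.apply_symm_apply]
      have h1' : L (e.symm f) = f + z • ((e.symm f : p) : E) := by
        rw [resolventShift_apply] at h1
        exact sub_eq_iff_eq_add.mp h1
      have hw' : w = ((e.symm f : p) : E) := by rw [hw, hg_apply]
      rw [hw', h1']
    · rintro ⟨u, hu⟩
      have hu1 : (u : E) = w := congrArg Prod.fst hu
      have hu2 : L u = f + z • w := congrArg Prod.snd hu
      have h2 : resolventShift p L z u = f := by
        rw [resolventShift_apply, hu2, hu1]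
        abel
      have h3 : e.symm f = u := by rw [← h2, ← he, LinearEquiv.symm_apply_apply]
      rw [hg_apply, h3, hu1]
  have hclosed : IsClosed (g.graph : Set (E × E)) := by
    rw [hgraph]
    exact hL.preimage (by fun_prop)
  have hcont : Continuous g := g.continuous_of_isClosed_graph hclosed
  let B : E →L[ℂ] E := ⟨g, hcont⟩
  have hB_apply : ∀ f : E, B f = ((e.symm f : p) : E) := fun f => rfl
  have hBmem : ∀ f : E, B f ∈ p := fun f => by rw [hB_apply]; exact (e.symm f).2
  refine ⟨B, ⟨hBmem, fun f => ?_, fun u => ?_⟩⟩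
  · have : (⟨B f, hBmem f⟩ : p) = e.symm f := by
      ext; rfl
    rw [this, ← he, LinearEquiv.apply_symm_apply]
  · rw [hB_apply, ← he, LinearEquiv.symm_apply_apply]

/-- **Pseudospectral enclosure for a closed operator, spectrum form**: under the hypotheses of
`exists_mem_closedBall_not_hasBoundedInverse` and closedness of the graph of `L`, some point of the
closed disc `|z − μ| ≤ r` is a spectral point of `L` (`L − z` not bijective).
[cite: Davies2007, Lemma 9.1.2 with Thm. 9.2.8; TrefethenEmbree2005, Thm. 4.3] -/
theorem exists_memSpectrum_closedBall_of_isClosed_graph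
    (hL : IsClosed {x : E × E | ∃ u : p, ((u : E), L u) = x}) {μ : ℂ} {r M ε : ℝ} (hr : 0 < r)
    (hM : ∀ z ∈ sphere μ r, ∃ B : E →L[ℂ] E, HasBoundedInverse p (resolventShift p L z) B ∧ ‖B‖ ≤ M)
    {v : p} (hv : v ≠ 0) (hres : ‖resolventShift p L μ v‖ ≤ ε * ‖(v : E)‖) (hMε : M * ε < 1) :
    ∃ z ∈ closedBall μ r, MemSpectrum p L z := by
  obtain ⟨z, hz, hno⟩ := exists_mem_closedBall_not_hasBoundedInverse hr hM hv hres hMε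
  refine ⟨z, hz, fun hbij => ?_⟩
  obtain ⟨B, hB⟩ := hasBoundedInverse_of_bijective_of_isClosed_graph hL hbij
  exact hno B hB

end Enclosure

end Literature.Analysis.OperatorTheory
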